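import Mathlib
import HarnessLib
import Literature.MathematicalPhysics.StatisticalMechanics.NextHamiltonianBoundsQ
import Literature.MathematicalPhysics.StatisticalMechanics.StepOperatorAKernelSub
import Literature.MathematicalPhysics.StatisticalMechanics.StepOperatorBKernelSubScale

/-!
# `‖H̃_a − H̃_b‖_{k,0} ≤ (δ_γ/h²)‖H‖_{k,0} + C_{8.7}·Cℓκ A^{−1}` for the torus data — the two-kernel difference of the
# extracted Hamiltonian `H̃ = A_kH + B_kK` ([ABKM19] Theorem 6.8 (6.55)–(6.57); Lemma 12.6 (12.51)–(12.53))

`StepOperatorAKernelSub.hamNorm_nextH_kernel_sub_le` bounds `‖H̃_a − H̃_b‖_{k,0}` by `(δ_γ/h²)‖H‖ + ‖B_aK − B_bK‖` under the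
abstract box / positivity hypotheses of `nextH_eq`, and `StepOperatorBKernelSubScale.hamNorm_opB_sub_abkm_le_scale_of_stepKernelBounds`
bounds `‖B_aK − B_bK‖_{k,0} ≤ C_{8.7}·Cℓκ A^{−1}` for the torus data.  This file discharges the box hypotheses for the torus data
(as `NextHamiltonianBoundsQ.hamNorm_nextH_abkm_le_of_stepKernelBounds` does) and combines the two:

* **`hamNorm_nextH_kernel_sub_abkm_le_of_stepKernelBounds`** — for two step data `D, Db` of scale `k` sharing the reference
  block `B_{x₀}` and its box corner, with `StepKernelBounds`, `L^{dk}|γ_q(D.𝒞) − γ_q(Db.𝒞)| ≤ δ_γ`, the pair property of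
  Lemma 8.4 on connected `k`-polymers (`‖(R_a − R_b)F‖ ≤ b·ℓ·κ^{|X|_k}`) and `‖K‖_k ≤ C`:
  `‖nextH D H K − nextH Db H K‖_{k,0} ≤ (δ_γ/h²)‖H‖_{k,0} + C_{8.7}·(Cℓκ A^{−1})`.

This is the block-product letter `Δt/(16e^{3/8})` of the two-kernel remainder bounds (line `banach_two_kernel` of the child
`TwoKernelSkBound` of the cruxes `HypACumulant` / `HypALocalTwoPoint`, route `Summits/HubbardSuperconductivity/…/Theses/ComplexGFFStiffness`).
Everything is proved; no named fact.

## References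
* S. Adams, S. Buchholz, R. Kotecký, S. Müller, arXiv:1910.13564, Theorem 6.8 (6.55)–(6.57), Lemma 10.6, Lemma 12.6
  (12.51)–(12.53) [AdamsBuchholzKoteckyMuller2019].
-/

noncomputable section

namespace Literature.MathematicalPhysics.StatisticalMechanics.GradientRG

open scoped BigOperators Classical
open Finset
open Literature.MathematicalPhysics.StatisticalMechanics.TorusPolymer
  (IsPolymer blocks blockOf thicken mem_blockOf_self isPolymer_blockOf boxCorner subset_thicken numBlocks)
open Literature.Barriers.CriticalPhenomena.LongRangePhi4.Polymer (IsConn)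
open Literature.MathematicalPhysics.QuantumFieldTheory

variable {d M : ℕ} [NeZero M]

/-- **`‖H̃_a − H̃_b‖_{k,0} ≤ (δ_γ/h²)‖H‖_{k,0} + C_{8.7}·(Cℓκ A^{−1})` for the torus data** (module docstring): `d ≥ 3`,
`L` odd, `L ≥ 2^{d+3}+16R`, `M = L^N`, `k+1 ≤ N`, `p + d ≤ M_ord ≤ R`, `r₀ ≥ 3`, `A ≥ 1`, the weight tower of Theorem 7.1; two
step data `D, Db` sharing `B₀ = B_{x₀}` and its box corner with `StepKernelBounds`; `L^{dk}|γ_q(D.𝒞) − γ_q(Db.𝒞)| ≤ δ_γ`;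
the pair property on connected `k`-polymers; `K` local `C^{r₀}` with `‖K‖_k ≤ C`.
[cite: AdamsBuchholzKoteckyMuller2019, Theorem 6.8 (6.55)–(6.57) / Lemma 12.6 (12.51)–(12.53)] -/
theorem hamNorm_nextH_kernel_sub_abkm_le_of_stepKernelBounds {L N Mord R n p r₀ : ℕ}
    {θbar lam μ δ₁ δ₀ A𝒫 A𝒫a A𝒫b C₂a C₂b h A : ℝ}
    {𝒞 : ℕ → (Fin d → ZMod M) → ℝ} (hd : 3 ≤ d) (hLodd : Odd L) (hL : 2 ^ (d + 3) + 16 * R ≤ L)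
    (hM : M = L ^ N) {k : ℕ} (hkN : k + 1 ≤ N) (hp : d / 2 + 1 ≤ p) (hpM : p + d ≤ Mord) (hMR : Mord ≤ R)
    (hr₀ : 3 ≤ r₀)
    (hB : AbkmWeightBounds L N Mord R n θbar lam μ δ₁ δ₀ A𝒫 𝒞
      (abkmWeightData L N Mord R θbar (schedDelta δ₀ δ₁ N) 𝒞))
    (hh : 0 < h) (hA : 1 ≤ A)
    (D Db : StepData d M)
    (hS : StepKernelBounds (abkmWeightData L N Mord R θbar (schedDelta δ₀ δ₁ N) 𝒞) L k A𝒫a C₂a D.𝒞)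
    (hSb : StepKernelBounds (abkmWeightData L N Mord R θbar (schedDelta δ₀ δ₁ N) 𝒞) L k A𝒫b C₂b Db.𝒞)
    {x₀ : Fin d → ZMod M} (hB₀ : D.B₀ = blockOf (L ^ k) x₀)
    (hc₀ : D.c₀ = boxCorner (L ^ k) (starRad R L d k) x₀) (hDbB : Db.B₀ = D.B₀) (hDbc : Db.c₀ = D.c₀)
    {δγ : ℝ} (hδγ : 0 ≤ δγ)
    (hγab : ∀ q, ((L ^ (d * k) : ℕ) : ℝ) * |gradCov D.𝒞 q - gradCov Db.𝒞 q| ≤ δγ)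
    {ℓ κ : ℝ}
    (hdiff : ∀ X : Finset (Fin d → ZMod M), IsPolymer (L ^ k) X → IsConn X →
      ∀ (F : ((Fin d → ZMod M) → ℝ) → ℂ) (C : ℝ), 0 ≤ C → ContDiff ℝ r₀ F →
        IsGaugeLocal ((abkmNormParams L N Mord R p r₀ h θbar A (schedDelta δ₀ δ₁ N) 𝒞).gauge k X) F →
        TayNormLE ((abkmNormParams L N Mord R p r₀ h θbar A (schedDelta δ₀ δ₁ N) 𝒞).gauge k X) r₀
          ((abkmWeightData L N Mord R θbar (schedDelta δ₀ δ₁ N) 𝒞).weight k X) F C →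
          TayNormLE ((abkmNormParams L N Mord R p r₀ h θbar A (schedDelta δ₀ δ₁ N) 𝒞).gauge k X) r₀
            ((abkmWeightData L N Mord R θbar (schedDelta δ₀ δ₁ N) 𝒞).midWeight k X)
            (fluct D.𝒞 F - fluct Db.𝒞 F) (C * ℓ * κ ^ numBlocks (L ^ k) X))
    (H : RelevantHamiltonian ℂ d)
    {K : Finset (Fin d → ZMod M) → ((Fin d → ZMod M) → ℝ) → ℂ} {C : ℝ} (hC : 0 ≤ C)
    (hK : WeakNormLE (abkmNormParams L N Mord R p r₀ h θbar A (schedDelta δ₀ δ₁ N) 𝒞) k K C)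
    (hKd : ∀ X, ContDiff ℝ r₀ (K X))
    (hKloc : ∀ X, IsPolymer (L ^ k) X → IsConn X →
      IsGaugeLocal ((abkmNormParams L N Mord R p r₀ h θbar A (schedDelta δ₀ δ₁ N) 𝒞).gauge k X) (K X)) :
    hamNorm (fieldWt h L d k) ((L : ℝ) ^ k) (L ^ (d * k)) (nextH D H K - nextH Db H K) ≤
      δγ / h ^ 2 * hamNorm (fieldWt h L d k) ((L : ℝ) ^ k) (L ^ (d * k)) H +
        pi2BoundConst d (((2 * R + 2 : ℕ) : ℝ) + ((d / 2 + 1 : ℕ) : ℝ)) * (C * ℓ * κ * A⁻¹) := by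
  have hd2 : 2 ≤ d := by omega
  have h8 : 8 ≤ 2 ^ (d + 3) := by
    calc 8 = 2 ^ 3 := by norm_num
      _ ≤ 2 ^ (d + 3) := Nat.pow_le_pow_right (by norm_num) (by omega)
  have hpR : p ≤ R := by omega
  have hL1 : 1 ≤ L := hLodd.pos
  obtain ⟨t, ht⟩ : ∃ t, N = k + t := ⟨N - k, by omega⟩
  have hMt0 : M = L ^ k * L ^ t := by rw [← pow_add, ← ht]; exact hM
  have htodd : Odd (L ^ t) := hLodd.pow
  -- the hypotheses of `nextH_eq` for both data
  have hC𝒞 : (Matrix.circulant D.𝒞).PosSemidef := hS.posSemidef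
  have hC𝒞b : (Matrix.circulant Db.𝒞).PosSemidef := hSb.posSemidef
  have hBne : D.B₀.card ≠ 0 := by
    rw [hB₀]; exact (card_pos.2 ⟨x₀, TorusPolymer.mem_blockOf_self _ x₀⟩).ne'
  obtain ⟨hwrap0, hroom0⟩ := abkm_box_lt (d := d) hL hpR hkN
  have hwrap : 4 * ((L ^ k - 1) / 2 + starRad R L d k) < M := by rw [hM]; exact hwrap0
  have hroomB : ∀ x ∈ D.B₀, HasRoom D.c₀ x (d / 2 + 1) := by
    intro x hx
    have hxS : x ∈ thicken (starRad R L d k) (blockOf (L ^ k) x₀) := by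
      rw [← hB₀]; exact TorusPolymer.subset_thicken _ _ hx
    have hin := (TorusPolymer.mem_thicken_blockOf_iff_inBox hMt0 hLodd.pow htodd hwrap x₀ x).1 hxS
    rw [hc₀]
    refine TorusPolymer.hasRoom_of_inBox hin ?_
    have h2 : ((2 * ((L ^ k - 1) / 2 + starRad R L d k) : ℕ) + ((d / 2 + 1 : ℕ) : ℤ)) * 2 < (M : ℤ) := by
      have : (2 * ((L ^ k - 1) / 2 + starRad R L d k) + (d / 2 + 1)) * 2 < M := by
        rw [hM]; have := hroom0; omega
      exact_mod_cast this
    exact_mod_cast h2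
  -- the abstract two-kernel bound and the scale-`k` bound of `B_aK − B_bK`
  have h1 := hamNorm_nextH_kernel_sub_le (h := h) hd2 hL1 hh hδγ k D Db hC𝒞 hC𝒞b hBne hroomB hDbB hDbc hγab H K
  have h2 := hamNorm_opB_sub_abkm_le_scale_of_stepKernelBounds (p := p) hd hLodd hL hM hkN hpM hMR hr₀ hB hh hA
    D Db hS hSb hB₀ hc₀ hDbB hDbc hdiff hC hK hKd hKloc
  exact h1.trans (add_le_add le_rfl h2)

end Literature.MathematicalPhysics.StatisticalMechanics.GradientRG

end
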